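import Summits.Ventures.LatticeQCDFlow.Scaling.CycleEndHubBracket

/-!
HONEST FRAMING: exact (Metropolis-corrected) sampling algorithms for lattice gauge theory; figures
of merit are autocorrelation/cost numbers at stated couplings and volumes; no continuum-physics
claim.

# CycleEndHubGainConcave — THE GAIN `G(u, u') = u(A) − u'(A) − Σ_C (u' − u)⁺` IS CONCAVE: ANY COUPLING OF TWO MIXTURES BOUNDS IT FROM BELOW BY THE MIXED GAINS,
# A COMMON POINT MASS SCALES IT (`G((1−σ)δ_z + σu, (1−σ)δ_z + σu') = σ·G(u,u')`), AND ITS TERMINAL VALUES ARE `𝟙{a ∈ A} − 𝟙{b ∈ A} − 𝟙{b ∈ C, b ≠ a}` (lean-2 GEN-35, ours)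

Venture-side (OURS).  Cell `lqcd-flow` (pub-lqcd), unit `pub-lqcd-lean-2-g35`, 2026-08-29.  Chapter V (composition variables), file 4: the tool for estimating the gain of
file 2 (`CycleEndHubBracket`) at FINITE swap odds.  There `E_opt[Δ'] = Δ − G(u_x, u_y)` with `u_x, u_y` the one-copy laws of the cycle-end hub content; for the star
these laws are `σ`-resolvents of the one-copy hub chains, `u_x = (1−σ)δ_z + σ·Σ_v k_x(v)·U_x(v,·)` (first swap attempt picks level content `v` with probability `k_x(v)`,
then the chain continues from the new lumped state with end law `U_x(v,·)`; `σ = t/(t+h)`).  Since `G` is linear minus a sum of positive parts it is CONCAVE, so for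
ANY coupling `γ` of the two first-step laws `k_x, k_y`: `G(u_x,u_y) ≥ σ·Σ_{v,v'} γ(v,v')·G(U_x(v,·), U_y(v',·))` — every Markovian path coupling of the two ONE-COPY hub
chains gives a lower bound for the optimal gain, attempt by attempt, down to the terminal values `G(δ_a, δ_b) ∈ {−1, 0, 1}` (`+1` iff `a ∈ A`, `b ∈ B`; `−1` iff `a ∉ A`,
`b ∉ B`, `a ≠ b` — file 1's `±1` rule again).  Pure finite sums; hypothesis-equations, no definitions, no chain.

## What is proved

* §1 `posPart_sum_mul_le` (Jensen for `t ↦ t⁺` with non-negative weights), `coupledMixture_sum_mul`, **`hubGain_concave`** (coupled mixtures: `G(Σγ•U, Σγ•U') ≥ Σ γ·G(U_i, U'_j)`).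
* §2 **`hubGain_pointMass_shift`** (`G((1−σ)δ_z + σu, (1−σ)δ_z + σu') = σ·G(u,u')`, `0 ≤ σ`), **`hubGain_firstStep_ge`** (the one-attempt path-coupling bound displayed above).
* §3 `hubGain_dirac` (`G(δ_a,δ_b) = 𝟙{a ∈ A} − 𝟙{b ∈ A} − 𝟙{b ∈ C ∧ b ≠ a}`), `hubGain_dirac_eq_one` (`a ∈ A`, `b ∈ B`), `hubGain_dirac_nonneg_of_A` ∕ `_of_B`, `hubGain_dirac_ge_neg_one`;
  `hubGain_le_one`, `hubGain_ge_neg_one` (probability vectors).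

Reading (no numerics implied): with file 2 this turns the fast-swap certificate into the analysis of ONE explicit coupling of two one-copy hub chains (same start `z`, compositions
`N_X`, `N_Y`), scored at the redraw by `𝟙{a ∈ A} − 𝟙{b ∈ A} − 𝟙{b ∈ C, b ≠ a}`.  NOT CLAIMED: any particular path coupling or estimate; anything measured.  Literature grade
(cell rule): OWN, elementary; nothing cited as a fact; no new bib keys.
-/

open Finset
open Literature.Probability.MarkovChains

namespace Summit.Ventures.LatticeQCDFlow.Scaling

section Concave
variable {S : Type*} [Fintype S] [DecidableEq S]

/-! ## §1 Concavity -/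

omit [Fintype S] [DecidableEq S] in
/-- Jensen for the positive part with non-negative weights: `(Σ_k γ_k t_k)⁺ ≤ Σ_k γ_k t_k⁺`. [ours] -/
theorem posPart_sum_mul_le {ι : Type*} (s : Finset ι) {γ t : ι → ℝ} (hγ : ∀ k ∈ s, 0 ≤ γ k) :
    max (∑ k ∈ s, γ k * t k) 0 ≤ ∑ k ∈ s, γ k * max (t k) 0 := by
  refine max_le ?_ (sum_nonneg fun k hk => mul_nonneg (hγ k hk) (le_max_right _ _))
  exact sum_le_sum fun k hk => mul_le_mul_of_nonneg_left (le_max_left _ _) (hγ k hk)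

omit [DecidableEq S] in
/-- Exchange of a coupled mixture with a weighted sum: `Σ_w (Σ_{i,j} γ(i,j)F_{ij}(w))·g(w) = Σ_{i,j} γ(i,j)·Σ_w F_{ij}(w)g(w)`. [ours] -/
theorem coupledMixture_sum_mul {I J : Type*} [Fintype I] [Fintype J] (γ : I → J → ℝ) (F : I → J → S → ℝ) (g : S → ℝ) :
    ∑ w, (∑ i, ∑ j, γ i j * F i j w) * g w = ∑ i, ∑ j, γ i j * ∑ w, F i j w * g w := by
  calc ∑ w, (∑ i, ∑ j, γ i j * F i j w) * g w
      = ∑ w, ∑ i, ∑ j, γ i j * (F i j w * g w) := by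
        refine sum_congr rfl fun w _ => ?_
        rw [sum_mul]
        refine sum_congr rfl fun i _ => ?_
        rw [sum_mul]
        refine sum_congr rfl fun j _ => ?_
        ring
    _ = ∑ i, ∑ w, ∑ j, γ i j * (F i j w * g w) := sum_comm
    _ = ∑ i, ∑ j, ∑ w, γ i j * (F i j w * g w) := sum_congr rfl fun i _ => sum_comm
    _ = ∑ i, ∑ j, γ i j * ∑ w, F i j w * g w := by
        refine sum_congr rfl fun i _ => sum_congr rfl fun j _ => ?_
        rw [mul_sum]

omit [DecidableEq S] in
/-- **CONCAVITY OF THE GAIN UNDER COUPLED MIXTURES.**  For non-negative weights `γ(i,j)` and families of laws `U_i`, `U'_j`, with `u = Σ_{i,j} γ(i,j)•U_i` and `u' = Σ_{i,j} γ(i,j)•U'_j`: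
`G(u,u') ≥ Σ_{i,j} γ(i,j)·G(U_i, U'_j)`, `G(u,u') = u(A) − u'(A) − Σ_C (u' − u)⁺`. [ours] -/
theorem hubGain_concave {I J : Type*} [Fintype I] [Fintype J] (NX NY : S → ℕ) (γ : I → J → ℝ) (hγ : ∀ i j, 0 ≤ γ i j) (U : I → S → ℝ) (U' : J → S → ℝ)
    (u u' : S → ℝ) (hu : ∀ w, u w = ∑ i, ∑ j, γ i j * U i w) (hu' : ∀ w, u' w = ∑ i, ∑ j, γ i j * U' j w) :
    ∑ i, ∑ j, γ i j * (∑ w, U i w * (if NY w < NX w then (1 : ℝ) else 0) - ∑ w, U' j w * (if NY w < NX w then (1 : ℝ) else 0)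
        - ∑ w, max (U' j w - U i w) 0 * (if NX w = NY w then (1 : ℝ) else 0))
      ≤ ∑ w, u w * (if NY w < NX w then (1 : ℝ) else 0) - ∑ w, u' w * (if NY w < NX w then (1 : ℝ) else 0)
        - ∑ w, max (u' w - u w) 0 * (if NX w = NY w then (1 : ℝ) else 0) := by
  -- the linear parts agree; the positive parts obey Jensen
  have hlinA : ∑ w, u w * (if NY w < NX w then (1 : ℝ) else 0) = ∑ i, ∑ j, γ i j * ∑ w, U i w * (if NY w < NX w then (1 : ℝ) else 0) := by
    rw [← coupledMixture_sum_mul γ (fun i _ w => U i w)]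
    exact sum_congr rfl fun w _ => by rw [hu]
  have hlinA' : ∑ w, u' w * (if NY w < NX w then (1 : ℝ) else 0) = ∑ i, ∑ j, γ i j * ∑ w, U' j w * (if NY w < NX w then (1 : ℝ) else 0) := by
    rw [← coupledMixture_sum_mul γ (fun _ j w => U' j w)]
    exact sum_congr rfl fun w _ => by rw [hu']
  have hpos : ∑ w, max (u' w - u w) 0 * (if NX w = NY w then (1 : ℝ) else 0)
      ≤ ∑ i, ∑ j, γ i j * ∑ w, max (U' j w - U i w) 0 * (if NX w = NY w then (1 : ℝ) else 0) := by
    rw [← coupledMixture_sum_mul γ (fun i j w => max (U' j w - U i w) 0)]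
    refine sum_le_sum fun w _ => mul_le_mul_of_nonneg_right ?_ (by split_ifs <;> norm_num)
    have hdiff : u' w - u w = ∑ i, ∑ j, γ i j * (U' j w - U i w) := by
      rw [hu, hu', ← sum_sub_distrib]
      refine sum_congr rfl fun i _ => ?_
      rw [← sum_sub_distrib]
      refine sum_congr rfl fun j _ => ?_
      ring
    rw [hdiff]
    calc max (∑ i, ∑ j, γ i j * (U' j w - U i w)) 0 ≤ ∑ i, max (∑ j, γ i j * (U' j w - U i w)) 0 := by
          have h := posPart_sum_mul_le (univ : Finset I) (γ := fun _ => (1 : ℝ)) (t := fun i => ∑ j, γ i j * (U' j w - U i w)) (fun _ _ => zero_le_one)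
          simp only [one_mul] at h
          exact h
      _ ≤ ∑ i, ∑ j, γ i j * max (U' j w - U i w) 0 := sum_le_sum fun i _ => posPart_sum_mul_le univ (fun j _ => hγ i j)
  have hsplit : ∑ i, ∑ j, γ i j * (∑ w, U i w * (if NY w < NX w then (1 : ℝ) else 0) - ∑ w, U' j w * (if NY w < NX w then (1 : ℝ) else 0)
        - ∑ w, max (U' j w - U i w) 0 * (if NX w = NY w then (1 : ℝ) else 0))
      = ∑ i, ∑ j, γ i j * ∑ w, U i w * (if NY w < NX w then (1 : ℝ) else 0) - ∑ i, ∑ j, γ i j * ∑ w, U' j w * (if NY w < NX w then (1 : ℝ) else 0)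
        - ∑ i, ∑ j, γ i j * ∑ w, max (U' j w - U i w) 0 * (if NX w = NY w then (1 : ℝ) else 0) := by
    rw [← sum_sub_distrib, ← sum_sub_distrib]
    refine sum_congr rfl fun i _ => ?_
    rw [← sum_sub_distrib, ← sum_sub_distrib]
    refine sum_congr rfl fun j _ => ?_
    ring
  rw [hsplit, hlinA, hlinA']
  linarith

/-! ## §2 A common point mass and the first-attempt bound -/

/-- **A common point mass scales the gain:** `G((1−σ)δ_z + σu, (1−σ)δ_z + σu') = σ·G(u, u')` for `0 ≤ σ`. [ours] -/
theorem hubGain_pointMass_shift (NX NY : S → ℕ) {σ : ℝ} (hσ : 0 ≤ σ) (z : S) (u u' ux uy : S → ℝ)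
    (hux : ∀ w, ux w = (1 - σ) * (if w = z then (1 : ℝ) else 0) + σ * u w) (huy : ∀ w, uy w = (1 - σ) * (if w = z then (1 : ℝ) else 0) + σ * u' w) :
    ∑ w, ux w * (if NY w < NX w then (1 : ℝ) else 0) - ∑ w, uy w * (if NY w < NX w then (1 : ℝ) else 0)
        - ∑ w, max (uy w - ux w) 0 * (if NX w = NY w then (1 : ℝ) else 0)
      = σ * (∑ w, u w * (if NY w < NX w then (1 : ℝ) else 0) - ∑ w, u' w * (if NY w < NX w then (1 : ℝ) else 0)
        - ∑ w, max (u' w - u w) 0 * (if NX w = NY w then (1 : ℝ) else 0)) := by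
  have hmax : ∀ w, max (uy w - ux w) 0 = σ * max (u' w - u w) 0 := by
    intro w
    rw [hux, huy]
    have : (1 - σ) * (if w = z then (1 : ℝ) else 0) + σ * u' w - ((1 - σ) * (if w = z then (1 : ℝ) else 0) + σ * u w) = σ * (u' w - u w) := by ring
    rw [this]
    rcases le_total 0 (u' w - u w) with h | h
    · rw [max_eq_left h, max_eq_left (mul_nonneg hσ h)]
    · rw [max_eq_right h, max_eq_right (mul_nonpos_of_nonneg_of_nonpos hσ h), mul_zero]
  simp_rw [hmax, hux, huy]
  rw [mul_sub, mul_sub, mul_sum, mul_sum, mul_sum, ← sum_sub_distrib, ← sum_sub_distrib, ← sum_sub_distrib, ← sum_sub_distrib]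
  refine sum_congr rfl fun w _ => ?_
  ring

/-- **THE FIRST-ATTEMPT PATH-COUPLING BOUND.**  If `u_x = (1−σ)δ_z + σ·Σ_v k_x(v)•U_x(v)` and `u_y = (1−σ)δ_z + σ·Σ_{v'} k_y(v')•U_y(v')` and `γ ≥ 0` couples `k_x` with `k_y`
(`Σ_{v'} γ(v,v') = k_x(v)`, `Σ_v γ(v,v') = k_y(v')`), then `G(u_x,u_y) ≥ σ·Σ_{v,v'} γ(v,v')·G(U_x(v), U_y(v'))`. [ours] -/
theorem hubGain_firstStep_ge {I J : Type*} [Fintype I] [Fintype J] (NX NY : S → ℕ) {σ : ℝ} (hσ : 0 ≤ σ) (z : S)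
    (kX : I → ℝ) (kY : J → ℝ) (γ : I → J → ℝ) (hγ : ∀ i j, 0 ≤ γ i j) (hrow : ∀ i, ∑ j, γ i j = kX i) (hcol : ∀ j, ∑ i, γ i j = kY j)
    (UX : I → S → ℝ) (UY : J → S → ℝ) (ux uy : S → ℝ)
    (hux : ∀ w, ux w = (1 - σ) * (if w = z then (1 : ℝ) else 0) + σ * ∑ i, kX i * UX i w)
    (huy : ∀ w, uy w = (1 - σ) * (if w = z then (1 : ℝ) else 0) + σ * ∑ j, kY j * UY j w) :
    σ * ∑ i, ∑ j, γ i j * (∑ w, UX i w * (if NY w < NX w then (1 : ℝ) else 0) - ∑ w, UY j w * (if NY w < NX w then (1 : ℝ) else 0)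
        - ∑ w, max (UY j w - UX i w) 0 * (if NX w = NY w then (1 : ℝ) else 0))
      ≤ ∑ w, ux w * (if NY w < NX w then (1 : ℝ) else 0) - ∑ w, uy w * (if NY w < NX w then (1 : ℝ) else 0)
        - ∑ w, max (uy w - ux w) 0 * (if NX w = NY w then (1 : ℝ) else 0) := by
  -- the mixtures behind `u_x`, `u_y`
  have hu : ∀ w, (fun w => ∑ i, kX i * UX i w) w = ∑ i, ∑ j, γ i j * UX i w := by
    intro w
    refine sum_congr rfl fun i _ => ?_
    rw [← sum_mul, hrow]
  have hu' : ∀ w, (fun w => ∑ j, kY j * UY j w) w = ∑ i, ∑ j, γ i j * UY j w := by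
    intro w
    show ∑ j, kY j * UY j w = ∑ i, ∑ j, γ i j * UY j w
    rw [sum_comm]
    refine sum_congr rfl fun j _ => ?_
    rw [← sum_mul, hcol]
  have hc := hubGain_concave NX NY γ hγ UX UY (fun w => ∑ i, kX i * UX i w) (fun w => ∑ j, kY j * UY j w) hu hu'
  rw [hubGain_pointMass_shift NX NY hσ z (fun w => ∑ i, kX i * UX i w) (fun w => ∑ j, kY j * UY j w) ux uy hux huy]
  exact mul_le_mul_of_nonneg_left hc hσ

/-! ## §3 Terminal values and range -/

/-- **The gain at two point masses:** `G(δ_a, δ_b) = 𝟙{a ∈ A} − 𝟙{b ∈ A} − 𝟙{b ∈ C ∧ b ≠ a}`. [ours] -/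
theorem hubGain_dirac (NX NY : S → ℕ) (a b : S) :
    ∑ w, (if w = a then (1 : ℝ) else 0) * (if NY w < NX w then (1 : ℝ) else 0) - ∑ w, (if w = b then (1 : ℝ) else 0) * (if NY w < NX w then (1 : ℝ) else 0)
        - ∑ w, max ((if w = b then (1 : ℝ) else 0) - (if w = a then (1 : ℝ) else 0)) 0 * (if NX w = NY w then (1 : ℝ) else 0)
      = (if NY a < NX a then (1 : ℝ) else 0) - (if NY b < NX b then (1 : ℝ) else 0) - (if NX b = NY b ∧ b ≠ a then (1 : ℝ) else 0) := by
  simp_rw [ite_mul, one_mul, zero_mul, sum_ite_eq', mem_univ, if_true]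
  congr 1
  rw [sum_eq_single b]
  · rw [if_pos rfl]
    by_cases hba : b = a
    · subst hba; rw [if_pos rfl, sub_self, max_eq_right le_rfl, zero_mul]; simp
    · rw [if_neg hba, sub_zero, max_eq_left zero_le_one, one_mul]
      by_cases hc : NX b = NY b
      · rw [if_pos hc, if_pos ⟨hc, hba⟩]
      · rw [if_neg hc, if_neg (fun h => hc h.1)]
  · intro w _ hwb
    rw [if_neg hwb, zero_sub]
    have : max (-(if w = a then (1 : ℝ) else 0)) 0 = 0 := max_eq_right (by split_ifs <;> norm_num)
    rw [this, zero_mul]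
  · intro h; exact absurd (mem_univ b) h

omit [Fintype S] in
/-- `a ∈ A`, `b ∈ B ⇒ G(δ_a, δ_b) = 1`. [ours] -/
theorem hubGain_dirac_eq_one (NX NY : S → ℕ) {a b : S} (ha : NY a < NX a) (hb : NX b < NY b) :
    (if NY a < NX a then (1 : ℝ) else 0) - (if NY b < NX b then (1 : ℝ) else 0) - (if NX b = NY b ∧ b ≠ a then (1 : ℝ) else 0) = 1 := by
  rw [if_pos ha, if_neg (not_lt.mpr hb.le), if_neg (show ¬(NX b = NY b ∧ b ≠ a) from fun h => absurd h.1 (ne_of_lt hb))]; ring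

omit [Fintype S] in
/-- `a ∈ A ⇒ G(δ_a, δ_b) ≥ 0`. [ours] -/
theorem hubGain_dirac_nonneg_of_A (NX NY : S → ℕ) {a : S} (b : S) (ha : NY a < NX a) :
    0 ≤ (if NY a < NX a then (1 : ℝ) else 0) - (if NY b < NX b then (1 : ℝ) else 0) - (if NX b = NY b ∧ b ≠ a then (1 : ℝ) else 0) := by
  rw [if_pos ha]
  by_cases h1 : NY b < NX b
  · rw [if_pos h1, if_neg (show ¬(NX b = NY b ∧ b ≠ a) from fun h => absurd h.1 (ne_of_gt h1))]; norm_num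
  · rw [if_neg h1]; split_ifs <;> norm_num

omit [Fintype S] in
/-- `b ∈ B ⇒ G(δ_a, δ_b) ≥ 0`. [ours] -/
theorem hubGain_dirac_nonneg_of_B (NX NY : S → ℕ) (a : S) {b : S} (hb : NX b < NY b) :
    0 ≤ (if NY a < NX a then (1 : ℝ) else 0) - (if NY b < NX b then (1 : ℝ) else 0) - (if NX b = NY b ∧ b ≠ a then (1 : ℝ) else 0) := by
  rw [if_neg (not_lt.mpr hb.le), if_neg (show ¬(NX b = NY b ∧ b ≠ a) from fun h => absurd h.1 (ne_of_lt hb))]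
  split_ifs <;> norm_num

omit [Fintype S] in
/-- `G(δ_a, δ_b) ≥ −1` always. [ours] -/
theorem hubGain_dirac_ge_neg_one (NX NY : S → ℕ) (a b : S) :
    -1 ≤ (if NY a < NX a then (1 : ℝ) else 0) - (if NY b < NX b then (1 : ℝ) else 0) - (if NX b = NY b ∧ b ≠ a then (1 : ℝ) else 0) := by
  by_cases h1 : NY b < NX b
  · rw [if_pos h1, if_neg (show ¬(NX b = NY b ∧ b ≠ a) from fun h => absurd h.1 (ne_of_gt h1))]; split_ifs <;> norm_num
  · rw [if_neg h1]; split_ifs <;> norm_num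

omit [DecidableEq S] in
/-- `G(u,u') ≤ 1` for a probability vector `u` and `u' ≥ 0`. [ours] -/
theorem hubGain_le_one (NX NY : S → ℕ) {u u' : S → ℝ} (hu0 : ∀ w, 0 ≤ u w) (hu1 : ∑ w, u w = 1) (hu'0 : ∀ w, 0 ≤ u' w) :
    ∑ w, u w * (if NY w < NX w then (1 : ℝ) else 0) - ∑ w, u' w * (if NY w < NX w then (1 : ℝ) else 0)
        - ∑ w, max (u' w - u w) 0 * (if NX w = NY w then (1 : ℝ) else 0) ≤ 1 := by
  have h1 : ∑ w, u w * (if NY w < NX w then (1 : ℝ) else 0) ≤ ∑ w, u w := by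
    refine sum_le_sum fun w _ => ?_
    split_ifs
    · rw [mul_one]
    · rw [mul_zero]; exact hu0 w
  rw [hu1] at h1
  have h2 : 0 ≤ ∑ w, u' w * (if NY w < NX w then (1 : ℝ) else 0) := sum_nonneg fun w _ => mul_nonneg (hu'0 w) (by split_ifs <;> norm_num)
  have h3 : 0 ≤ ∑ w, max (u' w - u w) 0 * (if NX w = NY w then (1 : ℝ) else 0) :=
    sum_nonneg fun w _ => mul_nonneg (le_max_right _ _) (by split_ifs <;> norm_num)
  linarith

omit [DecidableEq S] in
/-- `G(u,u') ≥ −1` for `u ≥ 0` and a probability vector `u'`. [ours] -/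
theorem hubGain_ge_neg_one (NX NY : S → ℕ) {u u' : S → ℝ} (hu0 : ∀ w, 0 ≤ u w) (hu'0 : ∀ w, 0 ≤ u' w) (hu'1 : ∑ w, u' w = 1) :
    -1 ≤ ∑ w, u w * (if NY w < NX w then (1 : ℝ) else 0) - ∑ w, u' w * (if NY w < NX w then (1 : ℝ) else 0)
        - ∑ w, max (u' w - u w) 0 * (if NX w = NY w then (1 : ℝ) else 0) := by
  have h1 : 0 ≤ ∑ w, u w * (if NY w < NX w then (1 : ℝ) else 0) := sum_nonneg fun w _ => mul_nonneg (hu0 w) (by split_ifs <;> norm_num)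
  -- the two `u'`-terms are supported on disjoint sets and each is at most `u'`
  have h2 : ∑ w, u' w * (if NY w < NX w then (1 : ℝ) else 0) + ∑ w, max (u' w - u w) 0 * (if NX w = NY w then (1 : ℝ) else 0) ≤ ∑ w, u' w := by
    rw [← sum_add_distrib]
    refine sum_le_sum fun w _ => ?_
    have hm : max (u' w - u w) 0 ≤ u' w := max_le (by linarith [hu0 w]) (hu'0 w)
    by_cases hA : NY w < NX w
    · rw [if_pos hA, if_neg (ne_of_gt hA), mul_one, mul_zero, add_zero]
    · rw [if_neg hA, mul_zero, zero_add]
      split_ifs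
      · rw [mul_one]; exact hm
      · rw [mul_zero]; exact hu'0 w
  rw [hu'1] at h2
  linarith

end Concave

end Summit.Ventures.LatticeQCDFlow.Scaling
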